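import Literature.MathematicalPhysics.QuantumFieldTheory.Balaban1983to89.B9Thm33G0DirXHolderAtPinsSmoothMembers
import Literature.MathematicalPhysics.QuantumFieldTheory.Balaban1983to89.B9GeoLemma21KLevelV1

/-!
# BalabanUVNodes ∕ N06 ([B9], `Dag.B9_main`) — ROWS 20–21's W-c HÖLDER FACE `hXd` (Φ^X_β∘∇_{U,ν}∘G₀∘D_U) AT def-Y's MEMBERS OF RECORD, AT THE SMOOTH-PARTITION
# PIN `bH13 x := weightNorm (bHZ x.toKIdx 1 p) (Lʲη)⁻¹`, FROM ONE DISPLAYED (3.45) SCHEMA READ AT THE SMOOTH BOND CLASS `bHZK x.toKIdx 1 p` — the member-∀ knit of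
# dag-n06-w6's `B9Thm33G0DirXHolderAtPinsSmoothMembers.pXdDH_pins_smooth_of_h45`

Track A of `YM-PLAN.md` (cell `pub-ymgap`, HUMAN RULING D-0062 ∕ D-0154), node **N06** = [Balaban1985BackgroundPropagators] Thms 3.1–3.15; width seat
`pub-ymgap-dag-n06-w6` (g3).  A HELPER for the stage-11 certificate editions of `pub-ymgap-dag-n06-d` (edition 39 of record `…AtOpsYNuOfRecordV6EPairNT`), in the
member-∀ binder shape of that seat's `N06ProbeZeroAtPinsPhys.hX0_of_pins` ∕ `N06DivLegAtPinsPhys.hdivDs_of_pins`.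

WHAT.  Editions 31–39 display rows 20–21's probe-valued Hölder member `hXd : ∀ x, M ≤ M_x → ∀ α₀ > 0, M_xα₀ ≤ a → ∀ U, Reg335 → Reg336 → ∀ ν β, 0 ≤ β → β < 1 →
HasMaj (bH13 x) (cNormR 1 (H x) (𝔭A x).blkPX _ (β − 1)) (((𝔭A x).ΦX U β ∘ₗ (𝔡A x).Dd U ν ∘ₗ (𝔬12 x).G0 U) ∘ₗ (𝔬12 x).Dv U) (BdX β·e^{−δ₃d})` with the source class `bH13`
FREE (no pin inside the sharp-cut class family is producible — dag-n06-w6 «SHARP-CUT JUMPS», `B9CoReadingCoordsInputJump`).  At the smooth-partition pin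
`bH13 x := weightNorm (bHZ x.toKIdx 1 p) (Lʲη)⁻¹` (dag-n06-l `B9SmoothHolderClassS.bHZ`, κ = 1 + C_Lip member-uniform) it is a THEOREM of:
* ONE displayed print-species schema `h45` — [B9] (3.45) for `Φ^X_β∘∇_{U,ν}∘G₀∘∇\*_{U,μ}` with input exponent 1 = β + (1 − β), read at the smooth bond class
  `bHZK x.toKIdx 1 p` (`p ≥ 1`; honest there: for λ localised in Δ̃(y′), `‖λ‖₁ + |λ| ≤ 3·loc_{y′} λ`), constants `BZ β`, rate `δ₀`, regime (M₀, a₀);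
* ONE displayed small-gauge binder `hΘ` at exponent 1 (`t⁻¹·‖U_μ(s) − U_μ(s′)‖ ≤ ϑ` on admissible same-direction pairs; gauge-VARIANT, dag-n06-l `GAUGE-VARIANCE-MEMO`);
* the certificate's member facts `hfacts` ([4] Lemma 2.1 (2.59)–(2.60) at the geometry of record, `B9RWSums347DefiniteFaces.facts347_exp261_geo9Y` ∕ `lemma21Pack_geo9Y`);
* the pins `hβ1 hbI0` (index-bond map), `hDvco12` (`D_U` = def-Y's `DvcoKH`), `hDds` (`∇\*_{U,μ}` = the slice-constant model of `cdsBₗ … μ`), the (3.35) class of `U`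
  (contracting links) and numerics (`0 ≤ δ₃`, `δ₃ + α_F·δ_F ≤ δ₀`, `0 ≤ L₀`, `0 ≤ ϑ`, `0 ≤ BZ β`);
[4] (2.61) at rate 1 is taken from `rowSum261_geo9Y` above ONE threshold.  ★★ `hXd_of_pins_smooth` states the knit ONCE: output
`∃ (MX : ℝ) (BdX : ℝ → ℝ), (∀ β, 0 ≤ β → β < 1 → 0 ≤ BdX β) ∧ ∀ x, MX ≤ M_x → ∀ α₀ > 0, M_xα₀ ≤ a₀ → ∀ U, Reg335 → Reg336 → ∀ ν β, 0 ≤ β → β < 1 → HasMaj (weightNorm (bHZ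
x.toKIdx 1 p) (Lʲη)⁻¹) (cNormR 1 (H x) (𝔭A x).blkPX _ (β − 1)) (((𝔭A x).ΦX U β ∘ₗ Dd x U ν ∘ₗ (𝔬12 x).G0 U) ∘ₗ (𝔬12 x).Dv U) (BdX β·e^{−δ₃d})` at the CLOSED witnesses
`MX := max (max M₀ M_L) M_F`, `BdX β := (d+1)·((1 + CLip d ℓ)·(BZ β·L₀)·((cR39 (trBasis N)·CJZ ℓ p ϑ·e^{δ_J·rZ d ℓ (rNear d ℓ + 1)})·L₀)·max c₁ 0)`, `δ_J := δ₃ + 1 + α_F·δ_F`.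
HONEST FRAMING.  Kernel bookkeeping (one application of dag-n06-w6's theorem per member, configuration, direction and exponent); COUNT-NEUTRAL; nothing of [B9]
asserted — the (3.45) schema, the gauge binder and the member facts are displayed here as hypotheses; `hXd` leaves a certificate's display only when an edition
pins `bH13` as above and displays `h45` + `hΘ`; N06 NOT discharged.  One finite 𝕋⁴ programme at fixed `ε` — NOT continuum, NOT OS, NOT the mass gap ∕ Clay.
0 `def`, 0 `sorry`.
-/

noncomputable section

namespace Summit.QuantumFields.YangMills.BalabanUVNodes.N06HolderXdAtPinsSmooth

open Literature.MathematicalPhysics.QuantumFieldTheory.Balaban1983to89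
open Literature.MathematicalPhysics.QuantumFieldTheory.Balaban1983to89.Node00 (FBondY IBondY)
open Literature.MathematicalPhysics.QuantumFieldTheory.Balaban1983to89.B9Thm34Ext (toB6)
open Literature.MathematicalPhysics.QuantumFieldTheory.Balaban1983to89.B11SectG (HasMaj BlockNorm RowSum)
open Literature.MathematicalPhysics.QuantumFieldTheory.Balaban1983to89.B9SectDSup (weightNorm)
open Literature.MathematicalPhysics.QuantumFieldTheory.Balaban1983to89.B9Thm312WholeClasses (cNormR)
open Literature.MathematicalPhysics.QuantumFieldTheory.Balaban1983to89.B9Thm312Whole (GeoOK)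
open Literature.MathematicalPhysics.QuantumFieldTheory.Balaban1983to89.B9RWSums343Holder (HolderProbes)
open Literature.MathematicalPhysics.QuantumFieldTheory.Balaban1983to89.B9RWSums343to347Whole (Facts347)
open Literature.MathematicalPhysics.QuantumFieldTheory.Balaban1983to89.B9CoReadingCoords (coordOpK XBK cdsBₗ)
open Literature.MathematicalPhysics.QuantumFieldTheory.Balaban1983to89.B9CoReadingCoordsS (XSK)
open Literature.MathematicalPhysics.QuantumFieldTheory.Balaban1983to89.B9CoReadingCoordsTranspose (TrIdx trBasis)
open Literature.MathematicalPhysics.QuantumFieldTheory.Balaban1983to89.B9Thm39ReadingCoords (cR39 cR39_nonneg)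
open Literature.MathematicalPhysics.QuantumFieldTheory.Balaban1983to89.B9PinMembersKLevelV1 (MemberY geo9Y bg9Y)
open Literature.MathematicalPhysics.QuantumFieldTheory.Balaban1983to89.B9GeoLemma21KLevelV1 (geo9Y_len_pos geo9Y_dist_triangle geo9Y_dist_comm rowSum261_geo9Y)
open Literature.MathematicalPhysics.QuantumFieldTheory.Balaban1983to89.B9GeoNormsKLevelV1 (geo9K_dist_nonneg)
open Literature.MathematicalPhysics.QuantumFieldTheory.Balaban1983to89.Node00.OpsYSectDCoords (DvcoKH)
open Literature.MathematicalPhysics.QuantumFieldTheory.Balaban1983to89.B9GradViaDivLettersSmoothTerms (CJZ rZ)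
open Literature.MathematicalPhysics.QuantumFieldTheory.Balaban1983to89.B9MultiscaleSmoothPartitionYLip (CLip CLip_nonneg)
open Literature.MathematicalPhysics.QuantumFieldTheory.Balaban1983to89.B9MultiscaleSmoothPartitionYNear (rNear)
open Literature.MathematicalPhysics.QuantumFieldTheory.Balaban1983to89.B9SmoothHolderClassS (bHZ)
open Literature.MathematicalPhysics.QuantumFieldTheory.Balaban1983to89.B9SmoothHolderClassK (bHZK)
open Literature.MathematicalPhysics.QuantumFieldTheory.Balaban1983to89.B9Thm33G0DirXHolderAtPinsSmoothMembers (pXdDH_pins_smooth_of_h45)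
open Literature.MathematicalPhysics.QuantumFieldTheory.Balaban1983to89.B7Prop2SpecialUnitary (specialUnitaryUnits)
open Literature.MathematicalPhysics.QuantumFieldTheory.Balaban1983to89.B6GlobalChartV1 (PV blkV1)
open Literature.MathematicalPhysics.QuantumFieldTheory.Balaban1983to89.B6Ineq2142KLevelV1 (β)
open Literature.MathematicalPhysics.QuantumFieldTheory.Balaban1983to89.B6KLevelCensusIndexV1 (Adm tpar)
open Literature.MathematicalPhysics.QuantumFieldTheory.Balaban1983to89.B6Geom246MultiLevelTorus (geomT)
open scoped Matrix.Norms.L2Operator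

variable {d ℓ : ℕ} {hd : 1 ≤ d + 1} {hL : Odd (ℓ + 1) ∧ 1 < ℓ + 1} {b₀ b₁ : ℝ} {Mstar : ℕ} {N : ℕ} [NeZero N]
variable [∀ x : MemberY d ℓ hd hL b₀ b₁ Mstar, Fintype (geo9Y x).Site]

/-- ★★ **`hXd` AT THE MEMBERS OF RECORD, AT THE SMOOTH PIN `bH13 x := weightNorm (bHZ x.toKIdx 1 p) (Lʲη)⁻¹`, FROM ONE DISPLAYED (3.45) SCHEMA AT `bHZK x.toKIdx 1 p`**
(module docstring): every member above `MX`, every `U` of the (3.35)∕(3.36) class in the regime (M₀, a₀), every direction `ν`, every `β ∈ [0,1)` —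
`HasMaj (weightNorm (bHZ x.toKIdx 1 p) (Lʲη)⁻¹) (𝔠_P^{(β−1)}) ((Φ^X_β ∘ Dd ν ∘ G₀) ∘ D_U) (BdX β·e^{−δ₃d})` with the closed witnesses `MX := max (max M₀ M_L) M_F` and
`BdX β := (d+1)·((1 + CLip d ℓ)·(BZ β·L₀)·((cR39 (trBasis N)·CJZ ℓ p ϑ·e^{δ_J·rZ d ℓ (rNear d ℓ + 1)})·L₀)·max c₁ 0)`, `δ_J := δ₃ + 1 + α_F·δ_F` — dag-n06-w6's
`pXdDH_pins_smooth_of_h45` (schedule ε β := 1 − β, dag-n06-l's smooth kinematic letter `J_μ(U)`) at the pins `hβ1 hbI0 hDvco12 hDds`, [4] (2.61) at rate 1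
(`rowSum261_geo9Y`), the member facts `hfacts`, the schema `h45` and the gauge binder `hΘ`.
[cite: Balaban1985BackgroundPropagators, Thm 3.3 (3.45) p.398 + (3.43) p.398 + (3.40) p.397 + (3.35) p.396 + (3.3) p.390 + Thms 3.12–3.13 pp.421–426; Balaban1984PropagatorsII, (2.51)–(2.56) pp.232–233 + Lemma 2.1 (2.59)–(2.61) pp.233–234] -/
theorem hXd_of_pins_smooth {PX PY Z : MemberY d ℓ hd hL b₀ b₁ Mstar → Type} [∀ x, Fintype (PX x)] [∀ x, Fintype (PY x)]
    (H : MemberY d ℓ hd hL b₀ b₁ Mstar → Prop)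
    (bI : ∀ x : MemberY d ℓ hd hL b₀ b₁ Mstar, FBondY x.toKIdx → IBondY x.toKIdx)
    (hβ1 : ∀ (x : MemberY d ℓ hd hL b₀ b₁ Mstar) (f : FBondY x.toKIdx), (geomT x.D).dist (β x.hN x.D x.hk (bI x f)) (blkV1 x.hN x.D f) ≤ 1)
    (hbI0 : ∀ (x : MemberY d ℓ hd hL b₀ b₁ Mstar) (f : FBondY x.toKIdx), bI x f = bI x ⟨f.src, 0⟩)
    (𝔭A : ∀ x : MemberY d ℓ hd hL b₀ b₁ Mstar, HolderProbes (geo9Y x) (bg9Y (Matrix (Fin N) (Fin N) ℂ) (specialUnitaryUnits (Fin N)) x) (XBK (TrIdx N) x.toKIdx)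
      (XBK (TrIdx N) x.toKIdx) (PX x) (PY x))
    (Dd Dds : ∀ x : MemberY d ℓ hd hL b₀ b₁ Mstar, (bg9Y (Matrix (Fin N) (Fin N) ℂ) (specialUnitaryUnits (Fin N)) x).Cfg → Fin (d + 1) →
      Module.End ℝ (XBK (TrIdx N) x.toKIdx → ℝ))
    (hDds : ∀ (x : MemberY d ℓ hd hL b₀ b₁ Mstar) (U : (bg9Y (Matrix (Fin N) (Fin N) ℂ) (specialUnitaryUnits (Fin N)) x).Cfg),
      Dds x U = fun μ => coordOpK (trBasis N) (fun _ : Fin (d + 1) => cdsBₗ x.toKIdx U μ))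
    (𝔬12 : ∀ x : MemberY d ℓ hd hL b₀ b₁ Mstar, B9Thm312Whole.Ops (geo9Y x) (bg9Y (Matrix (Fin N) (Fin N) ℂ) (specialUnitaryUnits (Fin N)) x)
      (XBK (TrIdx N) x.toKIdx) (XBK (TrIdx N) x.toKIdx) (Z x) (XSK (TrIdx N) x.toKIdx))
    (hDvco12 : ∀ (x : MemberY d ℓ hd hL b₀ b₁ Mstar) (U : (bg9Y (Matrix (Fin N) (Fin N) ℂ) (specialUnitaryUnits (Fin N)) x).Cfg),
      (𝔬12 x).Dv U = DvcoKH x.toKIdx (trBasis N) (bg9Y (Matrix (Fin N) (Fin N) ℂ) (specialUnitaryUnits (Fin N)) x) (fun U => U) U)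
    {p ϑ δ₀ δ₃ M₀ a₀ c35 MF δF αF L₀ : ℝ} {dF : ℕ} {BZ : ℝ → ℝ}
    (h1p : 1 ≤ p) (hϑ : 0 ≤ ϑ) (hBZ : ∀ b, 0 ≤ b → b < 1 → 0 ≤ BZ b) (hL₀ : 0 ≤ L₀) (hδ₃ : 0 ≤ δ₃) (hαδ : 0 ≤ αF * δF) (hδ₃0 : δ₃ + αF * δF ≤ δ₀)
    (hfacts : ∀ x : MemberY d ℓ hd hL b₀ b₁ Mstar, MF ≤ (geo9Y x).M → Facts347 (geo9Y x) 1 (H x) dF δF αF L₀)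
    (hΘ : ∀ x : MemberY d ℓ hd hL b₀ b₁ Mstar, M₀ ≤ (geo9Y x).M → ∀ α₀ : ℝ, 0 < α₀ → (geo9Y x).M * α₀ ≤ a₀ →
      ∀ U : (bg9Y (Matrix (Fin N) (Fin N) ℂ) (specialUnitaryUnits (Fin N)) x).Cfg,
        (bg9Y (Matrix (Fin N) (Fin N) ℂ) (specialUnitaryUnits (Fin N)) x).Reg335 c35 α₀ U →
        (bg9Y (Matrix (Fin N) (Fin N) ℂ) (specialUnitaryUnits (Fin N)) x).Reg336 c35 α₀ U →
          ∀ (μ : Fin (d + 1)) (s s' : Site (PV d ℓ x.toKIdx.m x.toKIdx.K hd hL) 0), Adm x.toKIdx ⟨s, μ⟩ ⟨s', μ⟩ →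
            tpar x.toKIdx ⟨s, μ⟩ ⟨s', μ⟩ ^ (-(1 : ℝ)) * ‖(U μ s : Matrix (Fin N) (Fin N) ℂ) - (U μ s' : Matrix (Fin N) (Fin N) ℂ)‖ ≤ ϑ)
    (h45 : ∀ x : MemberY d ℓ hd hL b₀ b₁ Mstar, M₀ ≤ (geo9Y x).M → ∀ α₀ : ℝ, 0 < α₀ → (geo9Y x).M * α₀ ≤ a₀ →
      ∀ U : (bg9Y (Matrix (Fin N) (Fin N) ℂ) (specialUnitaryUnits (Fin N)) x).Cfg,
        (bg9Y (Matrix (Fin N) (Fin N) ℂ) (specialUnitaryUnits (Fin N)) x).Reg335 c35 α₀ U →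
        (bg9Y (Matrix (Fin N) (Fin N) ℂ) (specialUnitaryUnits (Fin N)) x).Reg336 c35 α₀ U →
          letI : Fintype (B9GeoNormsKLevelV1.geo9K x.toKIdx).Site := (inferInstance : Fintype (geo9Y x).Site)
          ∀ (ν μ : Fin (d + 1)) (b : ℝ), 0 ≤ b → b < 1 →
            HasMaj (bHZK (κ := TrIdx N) x.toKIdx (R := (1 : ℝ)) (H := H x) (zero_le_one : (0 : ℝ) ≤ 1) le_rfl h1p)
              (BlockNorm.ofBlocks (toB6 (geo9Y x) 1 (H x)) (𝔭A x).blkPX) ((𝔭A x).ΦX U b ∘ₗ (Dd x U ν ∘ₗ ((𝔬12 x).G0 U ∘ₗ Dds x U μ)))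
              (fun a a' => BZ b * (geo9Y x).len a ^ (-b) * Real.exp (-(δ₀ * (geo9Y x).dist a a')))) :
    ∃ (MX : ℝ) (BdX : ℝ → ℝ), (∀ b, 0 ≤ b → b < 1 → 0 ≤ BdX b) ∧
      ∀ x : MemberY d ℓ hd hL b₀ b₁ Mstar, MX ≤ (geo9Y x).M → ∀ α₀ : ℝ, 0 < α₀ → (geo9Y x).M * α₀ ≤ a₀ →
        ∀ U : (bg9Y (Matrix (Fin N) (Fin N) ℂ) (specialUnitaryUnits (Fin N)) x).Cfg,
          (bg9Y (Matrix (Fin N) (Fin N) ℂ) (specialUnitaryUnits (Fin N)) x).Reg335 c35 α₀ U →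
          (bg9Y (Matrix (Fin N) (Fin N) ℂ) (specialUnitaryUnits (Fin N)) x).Reg336 c35 α₀ U →
            letI : Fintype (B9GeoNormsKLevelV1.geo9K x.toKIdx).Site := (inferInstance : Fintype (geo9Y x).Site)
            ∀ (ν : Fin (d + 1)) (b : ℝ), 0 ≤ b → b < 1 →
              HasMaj (weightNorm (bHZ (κ := TrIdx N) x.toKIdx (R := (1 : ℝ)) (H := H x) (zero_le_one : (0 : ℝ) ≤ 1) le_rfl h1p)
                  (fun y => ((geo9Y x).len y)⁻¹) (fun y => inv_nonneg.mpr (geo9Y_len_pos x y).le))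
                (cNormR 1 (H x) (𝔭A x).blkPX (fun y => (geo9Y_len_pos x y).le) (b - 1))
                (((𝔭A x).ΦX U b ∘ₗ Dd x U ν ∘ₗ (𝔬12 x).G0 U) ∘ₗ (𝔬12 x).Dv U)
                (fun a a' => BdX b * Real.exp (-(δ₃ * (geo9Y x).dist a a'))) := by
  -- [4] (2.61) at rate 1 above ONE threshold, constant floored at 0
  obtain ⟨ML, c₁, hrow⟩ := rowSum261_geo9Y (d := d) (ℓ := ℓ) (hd := hd) (hL := hL) (b₀ := b₀) (b₁ := b₁) (Mstar := Mstar) 1 one_pos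
  have hCJ : 0 ≤ cR39 (trBasis N) * CJZ ℓ p ϑ * Real.exp ((δ₃ + 1 + αF * δF) * rZ d ℓ (rNear d ℓ + 1)) := by
    have := cR39_nonneg (trBasis N)
    have hCJZ : 0 ≤ CJZ ℓ p ϑ := by unfold CJZ; positivity
    positivity
  refine ⟨max (max M₀ ML) MF,
    fun b => ((d : ℝ) + 1) * ((1 + CLip d ℓ) * (BZ b * L₀) *
      ((cR39 (trBasis N) * CJZ ℓ p ϑ * Real.exp ((δ₃ + 1 + αF * δF) * rZ d ℓ (rNear d ℓ + 1))) * L₀) * max c₁ 0),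
    fun b hb0 hb1 => ?_, fun x hM α₀ hα ha U hU hU' => ?_⟩
  · have := CLip_nonneg d ℓ
    have := hBZ b hb0 hb1
    have : (0 : ℝ) ≤ max c₁ 0 := le_max_right _ _
    positivity
  letI : Fintype (B9GeoNormsKLevelV1.geo9K x.toKIdx).Site := (inferInstance : Fintype (geo9Y x).Site)
  have hM₀ : M₀ ≤ (geo9Y x).M := ((le_max_left _ _).trans (le_max_left _ _)).trans hM
  have hML : ML ≤ (geo9Y x).M := ((le_max_right _ _).trans (le_max_left _ _)).trans hM
  have hMF : MF ≤ (geo9Y x).M := (le_max_right _ _).trans hM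
  have hgeoOK : GeoOK (geo9Y x) := ⟨geo9Y_dist_triangle x, geo9Y_dist_comm x, geo9K_dist_nonneg x.toKIdx, geo9Y_len_pos x⟩
  have hrowx : RowSum (toB6 (geo9Y x) 1 (H x)) 1 (max c₁ 0) := fun y => (hrow x hML y).trans (le_max_left _ _)
  exact pXdDH_pins_smooth_of_h45 x (hβ1 x) (hbI0 x) hU hϑ (hΘ x hM₀ α₀ hα ha U hU hU') h1p hgeoOK hrowx (hfacts x hMF)
    (hDvco12 x U) (hDds x U) hBZ (le_max_right _ _) (δJ := δ₃ + 1 + αF * δF) (by linarith only [hδ₃, hαδ]) hδ₃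
    (by linarith only [hδ₃0]) (by linarith only) (fun b hb0 hb1 => le_rfl) (h45 x hM₀ α₀ hα ha U hU hU')

end Summit.QuantumFields.YangMills.BalabanUVNodes.N06HolderXdAtPinsSmooth

end
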